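import Mathlib
import Literature.NumberTheory.LFunctions.Zhang2022.Section5Lemma54PartTwo
import Literature.NumberTheory.LFunctions.Zhang2022.Section5Lemma53CaseTwo
import HarnessLib

/-!
# Zhang (2022), §5, Lemma 5.4 (ii): the SIZE of the far part
# `∫_{(0,∞)∖W} |Δ(x)| x^{σ−1} dx` ("contributes `O(ε)`"), with free parameters, kernel-checked

Topic `Literature/NumberTheory/LFunctions/Zhang2022` (Landau–Siegel audit tree; verdict-neutral).
Y. Zhang, *Discrete mean estimates and the Landau–Siegel zero*, arXiv:2211.02515v1 (2022)
[Zhang2022LandauSiegel] — **an unrefereed manuscript under adjudication** (D-0069 width campaign,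
DAG node `Z22:Lem5.4`, PDF pp. 28–29, tex L1546–L1559):

> **Lemma 5.4.** … (ii). If `|s − 1| < 10α`, then `δ(s) = 1 + O(α log 𝓛)`.
> *Proof.* … (ii). Assume `|s − 1| < 10α`. By Lemma 5.3, on the right side of (5.14), the integral
> on the part `|x − t₀| ≥ 𝓛₁` contributes `O(ε)`. For `|x − t₀| < 𝓛₁` we have
> `x^{s−1} = 1 + O(α log 𝓛)`. Since `∫₀^∞ ω(1/2+2πix) dx = 1 + O(ε)`, (ii) follows.

The tree kernel-checks the STRUCTURE of (ii) (`Lemma53.norm_delta514_sub_one_le_explicit`,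
`Section5Lemma54PartTwo`: every term explicit except the far part
`∫_{(0,∞)∖W} ‖Δ(x)‖x^{σ−1} dx`, `W = (t₀ − ℓ, t₀ + ℓ)`), and says that its size is not asserted
there. This file bounds the far part, with free real parameters (`L₂ ≥ 1`, `t₀`, `ℓ`, a cut-off
`X₀`, contour parameters `U, ρ`), by exactly the manuscript's "By Lemma 5.3":

* `Lemma53.norm_Delta510_le_of_large` — **(5.9) in power form** (the tree's
  `norm_Delta510_le_caseTwo` with `c = 10⁻²`, `X = x^{0.99}`): for `x ≥ e`, `2t₀ < x^{0.99}` and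
  `10⁴m ≤ L₂²`, `‖Δ(x)‖ ≤ (2 + e/L₂)x^{−m} + e^{1+1/(16L₂²)}(√π/L₂)·N!·L₂ᴺ·x^{−0.99N}`;
* `Lemma53.integral_Ioi_norm_Delta510_mul_rpow_le` — the tail beyond `X₀`:
  `∫_{X₀}^∞ ‖Δ‖x^{σ−1} ≤ (2+e/L₂)X₀^{σ−m}/(m−σ) + e^{1+1/(16L₂²)}(√π/L₂)N!L₂ᴺ·X₀^{σ−0.99N}/(0.99N−σ)`;
* `Lemma53.norm_Delta510_le_off_window` — **(5.8) off the window** (the tree's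
  `norm_Delta510_sub_omega_le` + `tail_le`): for `0 < x ≤ X₀` with `|x − t₀| ≥ ℓ`,
  `‖Δ(x)‖ ≤ 3(√π/L₂)e^{−(πℓ/L₂)²} + (1+e^{1/(8L₂²)})(√(2π)/L₂)e^{−L₂²U²/2} + 4Ue^{−L₂²U²}`
  whenever `πX₀/L₂² ≤ U`, `√2·U ≤ ρ ≤ 1`, `4πX₀ρ² ≤ 1`;
* `Lemma53.setIntegral_norm_Delta510_mul_rpow_le_of_bound` — `∫_S ‖Δ‖x^{σ−1} ≤ B·X₀^σ/σ` for
  `S ⊆ (0, X₀]` on which `‖Δ‖ ≤ B`;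
* `Lemma53.integral_far_le` — **the far part assembled**:
  `∫_{(0,∞)∖W} ‖Δ‖x^{σ−1} ≤ B·X₀^σ/σ + (tail beyond X₀)`.

The manuscript's values (`𝓛₂ = 𝓛⁴⁰⁰`, `𝓛₁ = 𝓛⁴⁰⁵`, `t₀ = 𝓛⁵¹⁹`; `X₀ = 𝓛⁵³⁰`) are substituted in
`Section5Lemma54Discharge`. What is NOT asserted: anything about Theorems 1–2 of the source or
about Landau–Siegel zeros; nothing here bears on the cell's verdict on (8.24). A proof file: no new
definitions, no new facts.

## References

* Y. Zhang, arXiv:2211.02515v1 (2022), §5 Lemma 5.3 (5.8)–(5.9), Lemma 5.4 (ii) and its proof,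
  (5.14). [cite: Zhang2022LandauSiegel, §5 Lemma 5.4 (ii)]
-/

noncomputable section

open Complex Real Set MeasureTheory Filter

namespace Literature.NumberTheory.LFunctions.Zhang2022

namespace Lemma53

open SmoothWeight

/-- `e^{−y} ≤ n!/yⁿ` for `y > 0` (from `yⁿ/n! ≤ eʸ`). [folklore] -/
private theorem exp_neg_le_factorial_div_pow {y : ℝ} (hy : 0 < y) (n : ℕ) :
    Real.exp (-y) ≤ (n.factorial : ℝ) / y ^ n := by
  have h := Real.pow_div_factorial_le_exp y hy.le n
  have hfac : (0 : ℝ) < n.factorial := by exact_mod_cast Nat.factorial_pos n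
  rw [div_le_iff₀ hfac] at h
  have hyn : 0 < y ^ n := pow_pos hy n
  rw [Real.exp_neg, inv_le_iff_one_le_mul₀ (Real.exp_pos y), div_mul_eq_mul_div,
    one_le_div hyn]
  linarith

/-! ## (5.9) in power form and the tail beyond `X₀` -/

/-- **(5.9) with `c = 10⁻²`, `X = x^{0.99}`, turned into powers of `x`**: for `L₂ ≥ 1`, `x ≥ e`
(so `log x ≥ 1`), `2t₀ < x^{0.99}` and a natural `m` with `10⁴m ≤ L₂²`,
`‖Δ(x)‖ ≤ (2 + e/L₂)·x^{−m} + e^{1+1/(16L₂²)}(√π/L₂)·N!·L₂ᴺ·x^{−0.99N}` for every `N`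
(`e^{−(L₂ log x/100)²} ≤ x^{−m}` since `(L₂ log x)²/10⁴ ≥ (L₂²/10⁴) log x ≥ m log x`, and
`e^{−x^{0.99}/L₂} ≤ N!(x^{0.99}/L₂)^{−N}`). [cite: Zhang2022LandauSiegel, §5 Lemma 5.3 (5.9)] -/
theorem norm_Delta510_le_of_large {L₂ : ℝ} (hL : 1 ≤ L₂) (t₀ : ℝ) {x : ℝ} (hx : Real.exp 1 ≤ x)
    (ht : 2 * t₀ < x ^ (99 / 100 : ℝ)) {m : ℕ} (hm : (10 : ℝ) ^ 4 * m ≤ L₂ ^ 2) (N : ℕ) :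
    ‖Delta510 L₂ t₀ x‖
      ≤ (2 + Real.exp 1 / L₂) * x ^ (-(m : ℝ))
        + Real.exp (1 + 1 / (16 * L₂ ^ 2)) * (Real.sqrt π / L₂)
            * ((N.factorial : ℝ) * L₂ ^ N * x ^ (-(99 / 100 * N : ℝ))) := by
  have hL0 : 0 < L₂ := by linarith
  have hx0 : 0 < x := lt_of_lt_of_le (Real.exp_pos 1) hx
  have hlog1 : 1 ≤ Real.log x := by rw [Real.le_log_iff_exp_le hx0]; exact hx
  have hlog0 : 0 ≤ Real.log x := by linarith
  -- (5.9) with `c = 1/100`, `X = x^{0.99}`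
  have hc : 0 ≤ 1 / 100 * Real.log x := by positivity
  have hX : 0 < x ^ (99 / 100 : ℝ) := Real.rpow_pos_of_pos hx0 _
  have hXle : x ^ (99 / 100 : ℝ) ≤ x * Real.exp (-(1 / 100 * Real.log x)) := by
    have e : x * Real.exp (-(1 / 100 * Real.log x)) = x ^ (99 / 100 : ℝ) := by
      rw [Real.rpow_def_of_pos hx0]
      nth_rewrite 1 [← Real.exp_log hx0]
      rw [← Real.exp_add]
      congr 1; ring
    rw [e]
  have h := norm_Delta510_le_caseTwo hL t₀ hx0.le hc hX hXle ht
  -- the Gaussian-in-log factor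
  have hg : Real.exp (-(1 / 100 * L₂ * Real.log x) ^ 2) ≤ x ^ (-(m : ℝ)) := by
    rw [Real.rpow_def_of_pos hx0]
    apply Real.exp_le_exp.mpr
    have h1 : (m : ℝ) * (10 : ℝ) ^ 4 ≤ L₂ ^ 2 := by linarith
    have h2 : (m : ℝ) * Real.log x * (10 : ℝ) ^ 4 ≤ L₂ ^ 2 * Real.log x := by nlinarith
    have h3 : L₂ ^ 2 * Real.log x ≤ L₂ ^ 2 * Real.log x ^ 2 := by
      apply mul_le_mul_of_nonneg_left _ (by positivity); nlinarith
    nlinarith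
  have hT1 : 2 * Real.exp (-(1 / 100 * L₂ * Real.log x) ^ 2) ≤ 2 * x ^ (-(m : ℝ)) := by
    linarith
  have hT2 : Real.exp (1 - (1 / 100 * L₂ * Real.log x) ^ 2) / L₂
      ≤ Real.exp 1 / L₂ * x ^ (-(m : ℝ)) := by
    rw [sub_eq_add_neg, Real.exp_add, mul_div_right_comm]
    exact mul_le_mul_of_nonneg_left hg (by positivity)
  -- the `e^{−x^{0.99}/L₂}` factor
  have hT3 : Real.exp (-(x ^ (99 / 100 : ℝ) / L₂))
      ≤ (N.factorial : ℝ) * L₂ ^ N * x ^ (-(99 / 100 * N : ℝ)) := by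
    have hy : 0 < x ^ (99 / 100 : ℝ) / L₂ := by positivity
    have h1 := exp_neg_le_factorial_div_pow hy N
    have hxN : 0 < x ^ (99 / 100 * N : ℝ) := Real.rpow_pos_of_pos hx0 _
    have e : (N.factorial : ℝ) / (x ^ (99 / 100 : ℝ) / L₂) ^ N
        = (N.factorial : ℝ) * L₂ ^ N * x ^ (-(99 / 100 * N : ℝ)) := by
      rw [div_pow, ← Real.rpow_mul_natCast hx0.le, Real.rpow_neg hx0.le]
      field_simp
    rw [e] at h1
    exact h1
  have hE0 : 0 ≤ Real.exp (1 + 1 / (16 * L₂ ^ 2)) * (Real.sqrt π / L₂) := by positivity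
  calc ‖Delta510 L₂ t₀ x‖ ≤ _ := h
    _ ≤ 2 * x ^ (-(m : ℝ)) + Real.exp 1 / L₂ * x ^ (-(m : ℝ))
        + Real.exp (1 + 1 / (16 * L₂ ^ 2)) * (Real.sqrt π / L₂)
            * ((N.factorial : ℝ) * L₂ ^ N * x ^ (-(99 / 100 * N : ℝ))) :=
        add_le_add (add_le_add hT1 hT2) (mul_le_mul_of_nonneg_left hT3 hE0)
    _ = _ := by ring

/-- **The tail of the far part beyond `X₀`**: for `L₂ ≥ 1`, `X₀ ≥ e`, `2t₀ < X₀^{0.99}`,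
`0 < σ ≤ 3/2`, `3 ≤ m` with `10⁴m ≤ L₂²` and `3 ≤ N`,
`∫_{X₀}^∞ ‖Δ(x)‖x^{σ−1} dx ≤ (2+e/L₂)·X₀^{σ−m}/(m−σ)
  + e^{1+1/(16L₂²)}(√π/L₂)·N!·L₂ᴺ·X₀^{σ−0.99N}/(0.99N−σ)` (integrate `norm_Delta510_le_of_large`).
[cite: Zhang2022LandauSiegel, §5 Lemma 5.4 (ii) (proof), Lemma 5.3 (5.9)] -/
theorem integral_Ioi_norm_Delta510_mul_rpow_le {L₂ t₀ X₀ σ : ℝ} (hL : 1 ≤ L₂)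
    (hX₀ : Real.exp 1 ≤ X₀) (ht : 2 * t₀ < X₀ ^ (99 / 100 : ℝ)) (hσ0 : 0 < σ) (hσ : σ ≤ 3 / 2)
    {m : ℕ} (hm3 : 3 ≤ m) (hm : (10 : ℝ) ^ 4 * m ≤ L₂ ^ 2) {N : ℕ} (hN : 3 ≤ N) :
    ∫ x in Ioi X₀, ‖Delta510 L₂ t₀ x‖ * x ^ (σ - 1)
      ≤ (2 + Real.exp 1 / L₂) * (X₀ ^ (σ - m) / (m - σ))
        + Real.exp (1 + 1 / (16 * L₂ ^ 2)) * (Real.sqrt π / L₂) * ((N.factorial : ℝ) * L₂ ^ N)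
            * (X₀ ^ (σ - 99 / 100 * N) / (99 / 100 * N - σ)) := by
  have hL0 : 0 < L₂ := by linarith
  have hX0 : 0 < X₀ := lt_of_lt_of_le (Real.exp_pos 1) hX₀
  have hm' : (3 : ℝ) ≤ m := by exact_mod_cast hm3
  have hN' : (3 : ℝ) ≤ N := by exact_mod_cast hN
  set A : ℝ := 2 + Real.exp 1 / L₂ with hA
  set E : ℝ := Real.exp (1 + 1 / (16 * L₂ ^ 2)) * (Real.sqrt π / L₂) * ((N.factorial : ℝ) * L₂ ^ N)
    with hE
  have hA0 : 0 ≤ A := by positivity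
  have hE0 : 0 ≤ E := by positivity
  -- exponents
  have hr1 : σ - 1 - m < -1 := by linarith
  have hr2 : σ - 1 - 99 / 100 * N < -1 := by nlinarith
  -- integrability
  have hf : IntegrableOn (fun x : ℝ => ‖Delta510 L₂ t₀ x‖ * x ^ (σ - 1)) (Ioi X₀) :=
    (integrableOn_norm_Delta510_mul_rpow hL t₀ hσ0).mono_set (Ioi_subset_Ioi hX0.le)
  have hg1 : IntegrableOn (fun x : ℝ => A * x ^ (σ - 1 - m)) (Ioi X₀) :=
    (integrableOn_Ioi_rpow_of_lt hr1 hX0).const_mul A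
  have hg2 : IntegrableOn (fun x : ℝ => E * x ^ (σ - 1 - 99 / 100 * N)) (Ioi X₀) :=
    (integrableOn_Ioi_rpow_of_lt hr2 hX0).const_mul E
  -- pointwise majorant
  have hpt : ∀ x ∈ Ioi X₀, ‖Delta510 L₂ t₀ x‖ * x ^ (σ - 1)
      ≤ A * x ^ (σ - 1 - m) + E * x ^ (σ - 1 - 99 / 100 * N) := by
    intro x hx
    have hxX : X₀ ≤ x := le_of_lt hx
    have hx0 : 0 < x := by linarith
    have hxe : Real.exp 1 ≤ x := hX₀.trans hxX
    have htx : 2 * t₀ < x ^ (99 / 100 : ℝ) :=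
      lt_of_lt_of_le ht (Real.rpow_le_rpow hX0.le hxX (by norm_num))
    have hd := norm_Delta510_le_of_large hL t₀ hxe htx hm N
    have hw : 0 ≤ x ^ (σ - 1) := Real.rpow_nonneg hx0.le _
    have e1 : x ^ (-(m : ℝ)) * x ^ (σ - 1) = x ^ (σ - 1 - m) := by
      rw [← Real.rpow_add hx0]; congr 1; ring
    have e2 : x ^ (-(99 / 100 * N : ℝ)) * x ^ (σ - 1) = x ^ (σ - 1 - 99 / 100 * N) := by
      rw [← Real.rpow_add hx0]; congr 1; ring
    calc ‖Delta510 L₂ t₀ x‖ * x ^ (σ - 1)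
        ≤ (A * x ^ (-(m : ℝ)) + Real.exp (1 + 1 / (16 * L₂ ^ 2)) * (Real.sqrt π / L₂)
            * ((N.factorial : ℝ) * L₂ ^ N * x ^ (-(99 / 100 * N : ℝ)))) * x ^ (σ - 1) :=
          mul_le_mul_of_nonneg_right hd hw
      _ = A * (x ^ (-(m : ℝ)) * x ^ (σ - 1)) + E * (x ^ (-(99 / 100 * N : ℝ)) * x ^ (σ - 1)) := by
          rw [hE]; ring
      _ = A * x ^ (σ - 1 - m) + E * x ^ (σ - 1 - 99 / 100 * N) := by rw [e1, e2]
  -- the two explicit integrals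
  have hI1 : ∫ x in Ioi X₀, x ^ (σ - 1 - m) = X₀ ^ (σ - m) / (m - σ) := by
    rw [integral_Ioi_rpow_of_lt hr1 hX0]
    rw [show σ - 1 - (m : ℝ) + 1 = σ - m by ring]
    rw [neg_div, ← div_neg, neg_sub]
  have hI2 : ∫ x in Ioi X₀, x ^ (σ - 1 - 99 / 100 * N)
      = X₀ ^ (σ - 99 / 100 * N) / (99 / 100 * N - σ) := by
    rw [integral_Ioi_rpow_of_lt hr2 hX0]
    rw [show σ - 1 - 99 / 100 * (N : ℝ) + 1 = σ - 99 / 100 * N by ring]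
    rw [neg_div, ← div_neg, neg_sub]
  calc ∫ x in Ioi X₀, ‖Delta510 L₂ t₀ x‖ * x ^ (σ - 1)
      ≤ ∫ x in Ioi X₀, (A * x ^ (σ - 1 - m) + E * x ^ (σ - 1 - 99 / 100 * N)) :=
        setIntegral_mono_on hf (hg1.add hg2) measurableSet_Ioi hpt
    _ = A * (∫ x in Ioi X₀, x ^ (σ - 1 - m))
        + E * ∫ x in Ioi X₀, x ^ (σ - 1 - 99 / 100 * N) := by
        rw [integral_add hg1 hg2, MeasureTheory.integral_const_mul, MeasureTheory.integral_const_mul]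
    _ = _ := by rw [hI1, hI2]

/-! ## (5.8) off the window, and the near part -/

/-- **(5.8) off the window** `W = (t₀ − ℓ, t₀ + ℓ)`: for `L₂ > 0`, `0 < t₀ ≤ X₀`, `0 ≤ ℓ`,
`0 < x ≤ X₀` with `|x − t₀| ≥ ℓ`, and contour parameters with `πX₀/L₂² ≤ U`, `√2·U ≤ ρ ≤ 1`,
`4πX₀ρ² ≤ 1` (so that (5.8) applies at `x` with `|V| = π|t₀ − x|/L₂² ≤ U`):
`‖Δ(x)‖ ≤ 3(√π/L₂)e^{−(πℓ/L₂)²} + (1+e^{1/(8L₂²)})(√(2π)/L₂)e^{−L₂²U²/2} + 4Ue^{−L₂²U²}`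
(`‖Δ‖ ≤ ω + ‖Δ − ω‖`, (5.8) via the tree's `norm_Delta510_sub_omega_le` + `tail_le`, and
`ω(1/2+2πix) ≤ (√π/L₂)e^{−(πℓ/L₂)²}` off the window). [cite: Zhang2022LandauSiegel, §5 Lemma 5.3 (5.8)] -/
theorem norm_Delta510_le_off_window {L₂ t₀ ℓ X₀ U ρ x : ℝ} (hL : 0 < L₂) (ht₀ : 0 < t₀)
    (ht₀X : t₀ ≤ X₀) (hℓ : 0 ≤ ℓ) (hx0 : 0 < x) (hxX : x ≤ X₀) (hxt : ℓ ≤ |x - t₀|)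
    (hU : π * X₀ / L₂ ^ 2 ≤ U) (hρ : Real.sqrt 2 * U ≤ ρ) (hρ1 : ρ ≤ 1)
    (hxρ : 4 * π * X₀ * ρ ^ 2 ≤ 1) :
    ‖Delta510 L₂ t₀ x‖
      ≤ 3 * (Real.sqrt π / L₂ * Real.exp (-(π * ℓ / L₂) ^ 2))
        + (1 + Real.exp (1 / (8 * L₂ ^ 2))) * (Real.sqrt (2 * π) / L₂)
            * Real.exp (-(L₂ ^ 2 * U ^ 2 / 2))
        + 4 * U * Real.exp (-(L₂ ^ 2 * U ^ 2)) := by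
  set V : ℝ := π * (t₀ - x) / L₂ ^ 2 with hV
  have hX0 : 0 < X₀ := lt_of_lt_of_le ht₀ ht₀X
  have hL2 : 0 < L₂ ^ 2 := by positivity
  have hU0 : 0 ≤ U := le_trans (by positivity) hU
  -- `|V| ≤ U`
  have htx : |t₀ - x| ≤ X₀ := by
    rw [abs_le]; constructor <;> linarith
  have hVU : |V| ≤ U := by
    rw [hV, abs_div, abs_mul, abs_of_pos Real.pi_pos, abs_of_pos hL2]
    exact le_trans (by gcongr) hU
  -- `√(U² + V²) ≤ ρ`
  have hρ' : Real.sqrt (U ^ 2 + (π * (t₀ - x) / L₂ ^ 2) ^ 2) ≤ ρ := by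
    rw [← hV]
    have hV2 : V ^ 2 ≤ U ^ 2 := by
      rw [← sq_abs V]; exact pow_le_pow_left₀ (abs_nonneg V) hVU 2
    calc Real.sqrt (U ^ 2 + V ^ 2) ≤ Real.sqrt (2 * U ^ 2) := Real.sqrt_le_sqrt (by linarith)
      _ = Real.sqrt 2 * U := by
          rw [Real.sqrt_mul' _ (sq_nonneg U), Real.sqrt_sq hU0]
      _ ≤ ρ := hρ
  have hxρ' : 4 * π * |x| * ρ ^ 2 ≤ 1 := by
    rw [abs_of_pos hx0]
    calc 4 * π * x * ρ ^ 2 ≤ 4 * π * X₀ * ρ ^ 2 := by gcongr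
      _ ≤ 1 := hxρ
  have h58 := norm_Delta510_sub_omega_le hL t₀ x hU0 hρ' hρ1 hxρ'
  rw [omega_half_eq hL.ne'] at h58
  have htail := tail_le hL hU0
  -- sizes of the factors in (5.8)
  have hρ0 : 0 ≤ ρ := le_trans (by positivity) hρ
  have hB2 : ρ + 4 * π * |x| * ρ ^ 2 ≤ 2 := by linarith
  have hB0 : 0 ≤ ρ + 4 * π * |x| * ρ ^ 2 := by positivity
  have hω0 := omegaLine_nonneg hL t₀ x
  set E : ℝ := Real.exp (-(L₂ ^ 2 * U ^ 2)) with hE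
  have hE0 : 0 ≤ E := (Real.exp_pos _).le
  have hin : omegaLine L₂ t₀ x + 2 * |π * (t₀ - x) / L₂ ^ 2| * E
      ≤ omegaLine L₂ t₀ x + 2 * U * E := by rw [← hV]; gcongr
  have hin0 : 0 ≤ omegaLine L₂ t₀ x + 2 * |π * (t₀ - x) / L₂ ^ 2| * E := by positivity
  -- `ω` off the window
  have hωℓ : omegaLine L₂ t₀ x ≤ Real.sqrt π / L₂ * Real.exp (-(π * ℓ / L₂) ^ 2) := by
    rw [omegaLine_def]
    apply mul_le_mul_of_nonneg_left _ (by positivity)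
    apply Real.exp_le_exp.mpr
    have h1 : π * ℓ / L₂ ≤ |π * (x - t₀) / L₂| := by
      rw [abs_div, abs_mul, abs_of_pos Real.pi_pos, abs_of_pos hL]
      gcongr
    have h2 : (π * ℓ / L₂) ^ 2 ≤ (π * (x - t₀) / L₂) ^ 2 := by
      rw [← sq_abs (π * (x - t₀) / L₂)]
      exact pow_le_pow_left₀ (by positivity) h1 2
    linarith
  -- assemble
  have hnorm : ‖Delta510 L₂ t₀ x‖
      ≤ ‖Delta510 L₂ t₀ x - (omegaLine L₂ t₀ x : ℂ)‖ + omegaLine L₂ t₀ x := by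
    calc ‖Delta510 L₂ t₀ x‖
        = ‖(Delta510 L₂ t₀ x - (omegaLine L₂ t₀ x : ℂ)) + (omegaLine L₂ t₀ x : ℂ)‖ := by
          rw [sub_add_cancel]
      _ ≤ ‖Delta510 L₂ t₀ x - (omegaLine L₂ t₀ x : ℂ)‖ + ‖(omegaLine L₂ t₀ x : ℂ)‖ :=
          norm_add_le _ _
      _ = _ := by rw [Complex.norm_real, Real.norm_of_nonneg hω0]
  calc ‖Delta510 L₂ t₀ x‖ ≤ _ := hnorm
    _ ≤ ((1 + Real.exp (1 / (8 * L₂ ^ 2))) * (Real.sqrt (2 * π) / L₂)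
            * Real.exp (-(L₂ ^ 2 * U ^ 2 / 2))
          + 2 * (omegaLine L₂ t₀ x + 2 * U * E)) + omegaLine L₂ t₀ x := by
        gcongr
        exact h58.trans (add_le_add htail (mul_le_mul hB2 hin hin0 (by norm_num)))
    _ = 3 * omegaLine L₂ t₀ x
          + (1 + Real.exp (1 / (8 * L₂ ^ 2))) * (Real.sqrt (2 * π) / L₂)
            * Real.exp (-(L₂ ^ 2 * U ^ 2 / 2))
          + 4 * U * E := by ring
    _ ≤ _ := by rw [hE]; gcongr

/-- **The near part against a uniform bound**: for `L₂ ≥ 1`, `σ > 0`, `X₀ > 0`, a measurable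
`S ⊆ (0, X₀]` and `‖Δ(x)‖ ≤ B` on `S` (`B ≥ 0`),
`∫_S ‖Δ(x)‖x^{σ−1} dx ≤ B·X₀^σ/σ` (`∫₀^{X₀} x^{σ−1} dx = X₀^σ/σ`).
[cite: Zhang2022LandauSiegel, §5 Lemma 5.4 (ii) (proof)] -/
theorem setIntegral_norm_Delta510_mul_rpow_le_of_bound {L₂ t₀ σ B X₀ : ℝ} {S : Set ℝ}
    (hL : 1 ≤ L₂) (hσ : 0 < σ) (hX₀ : 0 < X₀) (hS : S ⊆ Ioc 0 X₀) (hSm : MeasurableSet S)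
    (hB : 0 ≤ B) (hpt : ∀ x ∈ S, ‖Delta510 L₂ t₀ x‖ ≤ B) :
    ∫ x in S, ‖Delta510 L₂ t₀ x‖ * x ^ (σ - 1) ≤ B * (X₀ ^ σ / σ) := by
  have hf : IntegrableOn (fun x : ℝ => ‖Delta510 L₂ t₀ x‖ * x ^ (σ - 1)) S :=
    (integrableOn_norm_Delta510_mul_rpow hL t₀ hσ).mono_set (hS.trans Ioc_subset_Ioi_self)
  have hg : IntegrableOn (fun x : ℝ => B * x ^ (σ - 1)) (Ioc 0 X₀) := by
    have := intervalIntegral.intervalIntegrable_rpow' (a := 0) (b := X₀) (r := σ - 1)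
      (by linarith)
    exact ((intervalIntegrable_iff_integrableOn_Ioc_of_le hX₀.le).mp this).const_mul B
  have hval : ∫ x in Ioc 0 X₀, x ^ (σ - 1) = X₀ ^ σ / σ := by
    rw [← intervalIntegral.integral_of_le hX₀.le, integral_rpow (Or.inl (by linarith))]
    rw [show σ - 1 + 1 = σ by ring, Real.zero_rpow hσ.ne', sub_zero]
  calc ∫ x in S, ‖Delta510 L₂ t₀ x‖ * x ^ (σ - 1) ≤ ∫ x in S, B * x ^ (σ - 1) := by
        refine setIntegral_mono_on hf (hg.mono_set hS) hSm fun x hx => ?_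
        exact mul_le_mul_of_nonneg_right (hpt x hx) (Real.rpow_nonneg (hS hx).1.le _)
    _ ≤ ∫ x in Ioc 0 X₀, B * x ^ (σ - 1) := by
        refine setIntegral_mono_set hg ?_ (ae_of_all _ hS)
        refine (ae_restrict_iff' measurableSet_Ioc).mpr (ae_of_all _ fun x hx => ?_)
        exact mul_nonneg hB (Real.rpow_nonneg hx.1.le _)
    _ = B * (X₀ ^ σ / σ) := by rw [MeasureTheory.integral_const_mul, hval]

/-- **The far part of (5.14) assembled**: for `L₂ ≥ 1`, `σ > 0`, `X₀ > 0`, if `‖Δ(x)‖ ≤ B` for all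
`0 < x ≤ X₀` with `|x − t₀| ≥ ℓ` (`B ≥ 0`) and `∫_{X₀}^∞ ‖Δ‖x^{σ−1} ≤ T`, then
`∫_{(0,∞)∖(t₀−ℓ,t₀+ℓ)} ‖Δ(x)‖x^{σ−1} dx ≤ B·X₀^σ/σ + T` — the manuscript's "the integral on the
part `|x − t₀| ≥ 𝓛₁` contributes `O(ε)`", with the `O(ε)` explicit once `B, T` are.
[cite: Zhang2022LandauSiegel, §5 Lemma 5.4 (ii) (proof)] -/
theorem integral_far_le {L₂ t₀ ℓ σ X₀ B T : ℝ} (hL : 1 ≤ L₂) (hσ : 0 < σ) (hX₀ : 0 < X₀)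
    (hB : 0 ≤ B) (hnear : ∀ x : ℝ, 0 < x → x ≤ X₀ → ℓ ≤ |x - t₀| → ‖Delta510 L₂ t₀ x‖ ≤ B)
    (htail : ∫ x in Ioi X₀, ‖Delta510 L₂ t₀ x‖ * x ^ (σ - 1) ≤ T) :
    ∫ x in Ioi 0 \ Ioo (t₀ - ℓ) (t₀ + ℓ), ‖Delta510 L₂ t₀ x‖ * x ^ (σ - 1)
      ≤ B * (X₀ ^ σ / σ) + T := by
  set f : ℝ → ℝ := fun x => ‖Delta510 L₂ t₀ x‖ * x ^ (σ - 1) with hf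
  set S₁ : Set ℝ := Ioc 0 X₀ \ Ioo (t₀ - ℓ) (t₀ + ℓ) with hS₁
  set S₂ : Set ℝ := Ioi X₀ with hS₂
  have hfint : IntegrableOn f (Ioi 0) := integrableOn_norm_Delta510_mul_rpow hL t₀ hσ
  have hS₁sub : S₁ ⊆ Ioc 0 X₀ := fun _ hx => hx.1
  have hS₂sub : S₂ ⊆ Ioi 0 := Ioi_subset_Ioi hX₀.le
  have hUsub : S₁ ∪ S₂ ⊆ Ioi 0 := union_subset (hS₁sub.trans Ioc_subset_Ioi_self) hS₂sub
  have hRsub : Ioi 0 \ Ioo (t₀ - ℓ) (t₀ + ℓ) ⊆ S₁ ∪ S₂ := by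
    intro x hx
    rcases le_or_gt x X₀ with h | h
    · exact Or.inl ⟨⟨hx.1, h⟩, hx.2⟩
    · exact Or.inr h
  have hdisj : Disjoint S₁ S₂ := Disjoint.mono_left hS₁sub Ioc_disjoint_Ioi_same
  have hS₁m : MeasurableSet S₁ := measurableSet_Ioc.diff measurableSet_Ioo
  have hnn : 0 ≤ᵐ[volume.restrict (S₁ ∪ S₂)] f := by
    refine (ae_restrict_iff' (hS₁m.union measurableSet_Ioi)).mpr (ae_of_all _ fun x hx => ?_)
    have hx0 : (0 : ℝ) < x := hUsub hx
    exact mul_nonneg (norm_nonneg _) (Real.rpow_nonneg hx0.le _)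
  have h1 : ∫ x in S₁, f x ≤ B * (X₀ ^ σ / σ) := by
    refine setIntegral_norm_Delta510_mul_rpow_le_of_bound hL hσ hX₀ hS₁sub hS₁m hB
      fun x hx => hnear x hx.1.1 hx.1.2 ?_
    have hx' : ¬ (t₀ - ℓ < x ∧ x < t₀ + ℓ) := hx.2
    rcases not_and_or.mp hx' with h | h
    · rw [abs_sub_comm]; exact le_abs.mpr (Or.inl (by linarith))
    · exact le_abs.mpr (Or.inl (by linarith))
  calc ∫ x in Ioi 0 \ Ioo (t₀ - ℓ) (t₀ + ℓ), f x ≤ ∫ x in S₁ ∪ S₂, f x :=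
        setIntegral_mono_set (hfint.mono_set hUsub) hnn (ae_of_all _ hRsub)
    _ = (∫ x in S₁, f x) + ∫ x in S₂, f x :=
        setIntegral_union hdisj measurableSet_Ioi (hfint.mono_set (hS₁sub.trans Ioc_subset_Ioi_self))
          (hfint.mono_set hS₂sub)
    _ ≤ B * (X₀ ^ σ / σ) + T := add_le_add h1 htail

end Lemma53

end Literature.NumberTheory.LFunctions.Zhang2022
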